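import Summits.QuantumFields.BalabanUV.Beta.FP.ConstrainedBiLaplacianResponse
import Literature.MathematicalPhysics.QuantumFieldTheory.Balaban1983to89.B4Green242Bridge
import Literature.MathematicalPhysics.QuantumFieldTheory.Balaban1983to89.Beta.AffineAveraging

/-!
# `BalabanUV.Beta.FP.ConstrainedBiLaplacianResponseFull` — road «FP» for binder row D1, DESIGN ROW **GHOST-STEP** brick (g3) «(CONV-C)-Hb»,
# FILE 4a — THE RESPONSE MULTIPLIER READ AT A FINE POINT OF `ℤ^{d+1}`, ITS SYMBOL IDENTITIES UNDER `(−Δ)²` AND THE BLOCK SUM, and the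
# lattice-kernel tools of the junction (an2's `codiff₁∘dz = N^{−2}·negLap`, the box ≃ `Fin (d+1) → Fin N` reindexing, the multiplier symbol
# `(Δ^ξ)²∕den` and its strip regularity)

NOT IN PRINT; OUR PROOF ATTEMPT (binder row G-an2-4 ∕ (CONV-C), prover part P3 = fibre∕strip «Woodbury» lineage, gen 28; CRUX TEAM (2),
2026-08-21).  HONEST DEPENDENCY (cell records, verbatim): «continuum YM on T⁴ ⇐ BetaPertH ∧ nine spine estimates (0/9 proved); BetaPertH ⇐ (D1) ∧
(D4) ∧ CAP+tail; G-an2-4 gates asym, D1 and NE2/3/4.»  HONEST FRAMING (cell contract, verbatim): «discharging `BetaPertH` makes Bałaban's UV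
stability UNCONDITIONAL — a real constructive-QFT result; it is NOT the continuum limit and NOT the Clay problem.»  ABSOLUTE RULE (cell charter,
verbatim): «No internally-minted statement may enter as a cited fact. Every hypothesis is either kernel-proved in this package or a verbatim quotation
of a PUBLISHED theorem with page reference. The manuscript(s) under audit are NOT citable for their own disputed steps — they are the thing under
adjudication; programme-internal (2001/route/tribunal) claims are never citable.»  THIS MODULE is [folklore] lattice Fourier bookkeeping over the
vendored `B4Green244` §2–§5 calculus (`PhZ`, `PhZ_finePt`, `lap_PhZ`, `sum_PhZ_V`, `negLap`, `opD`, `latticeKernel_phase_mul` — the pattern of its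
`green244`; `B4Green242Bridge.latticeKernel_const_mul`), FILE 3 of this programme (`bvec`, `hM`, `symbol_mul_bvec`, `sum_Fc_mul_bvec`) and an2's `AffineAveraging` cochain operators BY NAME;
it cites nothing as a hypothesis, has FOUR bookkeeping `def`s (`Hfull`, `KH`, `omegaSym`, `omegaKer`), no `def … : Prop`, no `sorry`.

## Contents (dimension `d+1`; fine lattice `ℤ^{d+1}` with blocks of side `N ≥ 1`)

* §1 **`Hfull N s z p′ = Σ_k e^{i(p′+2πk)·z∕N}·(N^{−(d+1)}·bvec_k)`** (FILE 3's `hM` read at the fine point `z`: `Hfull_finePt`), the position-space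
  kernel **`KH N s z y := latticeKernel (hM N s (z mod N)) (⌊z∕N⌋ − y) = latticeKernel (Hfull N s z) (−y)`** (`KH_eq`), holomorphy on the zone.
* §2 symbol identities: **`negLap_sum_PhZ`** (`(−Δ)` acts on `Σ_k PhZ_k·c_k` alias by alias with `Δ^ξ(p′+2πk)`), `sum_PhZ_F_zero`
  (`Σ_k PhZ_k u_k = e^{ip′·⌊z∕N⌋}`), **`sum_finePt_PhZ`** (`Σ_j PhZ_k(N•x+j) = N^{d+1}·e^{ip′·x}·ũ_k`), `negLap_Hfull`, **`negLap_negLap_Hfull`**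
  (`(−Δ)²Hfull = N^{−(d+1)}·((Δ^ξ)²∕den)·e^{ip′·⌊z∕N⌋}` on the strip — FILE 3's FORCE-FREE row), **`sum_finePt_Hfull`** (`Σ_j Hfull(N•y+j) = e^{ip′·y}` —
  FILE 3's UNIT block sums).
* §3 tools: `omegaSym = (Δ^ξ)²∕den`, `omegaKer`, **`codiff₁_dz_eq_negLap`** (`codiff₁ (dz f) = N^{−2}·negLap N f`), `negLap_const_mul`, `negLap_eq_opD`,
  **`blockSum_eq_sum_finePt`** (an2's `Σ_{b ∈ box} f (N•y + b)` = `Σ_j f (finePt N y j)`), **`stripRegular_omegaSym`**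
  (`(Δ^ξ)²∕den = 1∕Ssum` on the sides, `Ssum_tr`; bound `(16(d+1))²∕cB`).

The junction with d1-p3's `BiLaplaceBlockResponse.Hb` is FILE 4b (`ConstrainedBiLaplacianResponseJunction`).  0∕4 row-D1 binders touched.  NOT (CONV-C),
NEVER «G-an2-4 closed», NOT the ghost step law, NOT SDF, NOT D1, NOT BetaPertH, NOT continuum, NOT Clay.  Provenance: prover-b2b-balaban-gan24-p3-g28-0
(unit `b2b-balaban-gan24-p3`, gen 28), 2026-08-21; no existing file touched.
-/

noncomputable section

namespace Summit.QuantumFields.BalabanUV.Beta.FP.ConstrainedBiLaplacianResponseFull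

open Complex Finset ComplexConjugate MeasureTheory
open Literature.MathematicalPhysics.QuantumFieldTheory
open Literature.MathematicalPhysics.QuantumFieldTheory.Balaban1983to89
open Literature.MathematicalPhysics.QuantumFieldTheory.Balaban1983to89.B4Strip
open Literature.MathematicalPhysics.QuantumFieldTheory.Balaban1983to89.B4StripCauchy
open Literature.MathematicalPhysics.QuantumFieldTheory.Balaban1983to89.B5Strip145Analytic
open Literature.MathematicalPhysics.QuantumFieldTheory.Balaban1983to89.B5Strip145Decay
open Literature.MathematicalPhysics.QuantumFieldTheory.Balaban1983to89.B4StripSums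
open Literature.MathematicalPhysics.QuantumFieldTheory.Balaban1983to89.B4StripSumsHolder (PhZ efZ differentiableAt_PhZ)
open Literature.MathematicalPhysics.QuantumFieldTheory.Balaban1983to89.B4ContourShift
open Literature.MathematicalPhysics.QuantumFieldTheory.Balaban1983to89.B4Green244 (e coarse offset finePt finePt_coarse_offset coarse_finePt
  phaseC V F_zero PhZ_finePt lap_PhZ sum_PhZ_V negLap blockAvg opD opD_latticeKernel latticeKernel_phase_mul latticeKernel_congr
  latticeKernel_sum_mul latticeKernel_one latticeKernel_phase integrableOn_of_differentiableAt)
open Literature.MathematicalPhysics.QuantumFieldTheory.Balaban1983to89.B4Green242Bridge (latticeKernel_const_mul)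
open Summit.QuantumFields.BalabanUV.Beta.FP.ConstrainedBiLaplacianStrip
open Summit.QuantumFields.BalabanUV.Beta.FP.ConstrainedBiLaplacianFibre
open Summit.QuantumFields.BalabanUV.Beta.FP.ConstrainedBiLaplacianFibreEntries
open Summit.QuantumFields.BalabanUV.Beta.FP.ConstrainedBiLaplacianFibreSides
open Summit.QuantumFields.BalabanUV.Beta.FP.ConstrainedBiLaplacianKernel
open Summit.QuantumFields.BalabanUV.Beta.FP.ConstrainedBiLaplacianFibreIdentities
open Summit.QuantumFields.BalabanUV.Beta.FP.ConstrainedBiLaplacianResponse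
open Literature.MathematicalPhysics.QuantumFieldTheory.Balaban1983to89.Beta.AffineAveraging (Site Form0 dz codiff₁ unitVec box toSite blockSum)
open scoped Real

variable {d : ℕ}

/-! ## §1 The full-phase multiplier of the response and its kernel -/

/-- [folklore] **THE RESPONSE MULTIPLIER READ AT THE FINE POINT `z ∈ ℤ^{d+1}`**: `Hfull N s z p′ = Σ_k e^{i(p′+2πk)·z∕N}·(N^{−(d+1)}·bvec_k)`. -/
def Hfull (N : ℕ) [NeZero N] (s : ℕ) (z : Fin (d + 1) → ℤ) (p : Fin (d + 1) → ℂ) : ℂ :=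
  ∑ k : Fin (d + 1) → Fin N, PhZ N k z p * ((((N : ℂ) ^ (d + 1))⁻¹) * bvec N s p k)

/-- [folklore] `Hfull (N x⁰ + τ) = e^{ip′·x⁰}·hM N s τ` — the full multiplier is the block phase times FILE 3's offset multiplier. -/
theorem Hfull_finePt (N : ℕ) [NeZero N] (s : ℕ) (x : Fin (d + 1) → ℤ) (j : Fin (d + 1) → Fin N) (P : Fin (d + 1) → ℂ) :
    Hfull N s (finePt N x j) P = cexp (I * phaseC P x) * hM N s j P := by
  unfold Hfull hM EF
  rw [Finset.mul_sum, Finset.mul_sum]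
  refine Finset.sum_congr rfl fun k _ => ?_
  rw [PhZ_finePt N (NeZero.ne N)]
  ring

/-- [folklore] **THE POSITION-SPACE KERNEL OF THE RESPONSE**: `KH N s z y = latticeKernel (hM N s (z mod N)) (⌊z∕N⌋ − y)` — the response at the
fine point `z` to the unit block sum prescribed at block `y`. -/
def KH (N : ℕ) [NeZero N] (s : ℕ) (z y : Fin (d + 1) → ℤ) : ℂ := latticeKernel (hM N s (offset N z)) (coarse N z - y)

/-- [folklore] `KH N s z y = latticeKernel (Hfull N s z) (−y)` (the block phase translates the kernel; `B4Green244.K_eq` pattern). -/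
theorem KH_eq (N : ℕ) [NeZero N] (s : ℕ) (z y : Fin (d + 1) → ℤ) : KH N s z y = latticeKernel (Hfull N s z) (-y) := by
  have hz : Hfull N s z = fun P => cexp (I * phaseC P (coarse N z)) * hM N s (offset N z) P := by
    funext P
    rw [← Hfull_finePt, finePt_coarse_offset]
  rw [hz, latticeKernel_phase_mul, KH, neg_add_eq_sub]

/-- [folklore] The real zone lies in the strip of FILE 1. -/
theorem ofRealVec_mem_strip (s : ℕ) {p : Fin (d + 1) → ℝ} (hp : p ∈ BZ (d + 1)) : ofRealVec p ∈ Strip (d + 1) (kappaB (d + 1) s) :=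
  ofRealVec_mem_Strip (kappaB_pos (d + 1) s).le hp

/-- [folklore] A linear combination of fine phases with coefficients holomorphic on the strip is holomorphic at every point of the real zone. -/
theorem differentiableAt_sum_PhZ (N : ℕ) [NeZero N] (s : ℕ) (c : (Fin (d + 1) → Fin N) → (Fin (d + 1) → ℂ) → ℂ)
    (hc : ∀ k, ∀ P ∈ Strip (d + 1) (kappaB (d + 1) s), DifferentiableAt ℂ (c k) P) (z : Fin (d + 1) → ℤ)
    (p : Fin (d + 1) → ℝ) (hp : p ∈ BZ (d + 1)) :
    DifferentiableAt ℂ (fun P => ∑ k : Fin (d + 1) → Fin N, PhZ N k z P * c k P) (ofRealVec p) := by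
  apply DifferentiableAt.fun_sum; intro k _
  exact (differentiableAt_PhZ N k z _).mul (hc k _ (ofRealVec_mem_strip s hp))

/-- [folklore] `Hfull N s z` is holomorphic at every point of the real zone. -/
theorem differentiableAt_Hfull (N : ℕ) [NeZero N] (s : ℕ) (z : Fin (d + 1) → ℤ) (p : Fin (d + 1) → ℝ) (hp : p ∈ BZ (d + 1)) :
    DifferentiableAt ℂ (Hfull N s z) (ofRealVec p) :=
  differentiableAt_sum_PhZ N s (fun k P => (((N : ℂ) ^ (d + 1))⁻¹) * bvec N s P k)
    (fun k _ hP => (differentiableAt_bvec N s k hP).const_mul _) z p hp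

/-! ## §2 The symbol identities -/

/-- [folklore] **`(−Δ)` ON A COMBINATION OF FINE PHASES, ALIAS BY ALIAS**: `negLap N (z ↦ Σ_k PhZ_k(z)·c_k) z = Σ_k PhZ_k(z)·(Δ^ξ(p′+2πk)·c_k)`
(`B4Green244.lap_PhZ` at `m² = 0`; `negLap` carries the `ξ^{−2} = N²`). -/
theorem negLap_sum_PhZ (N : ℕ) [NeZero N] (c : (Fin (d + 1) → Fin N) → ℂ) (z : Fin (d + 1) → ℤ) (P : Fin (d + 1) → ℂ) :
    negLap N (fun z' => ∑ k : Fin (d + 1) → Fin N, PhZ N k z' P * c k) z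
      = ∑ k : Fin (d + 1) → Fin N, PhZ N k z P * (DeltaXi N 0 (shift N k P) * c k) := by
  simp only [negLap]
  have h0 : ∀ μ : Fin (d + 1),
      2 * (∑ k : Fin (d + 1) → Fin N, PhZ N k z P * c k) - (∑ k : Fin (d + 1) → Fin N, PhZ N k (z + e μ) P * c k)
        - (∑ k : Fin (d + 1) → Fin N, PhZ N k (z - e μ) P * c k)
        = ∑ k : Fin (d + 1) → Fin N, (2 * PhZ N k z P - PhZ N k (z + e μ) P - PhZ N k (z - e μ) P) * c k := by
    intro μ
    rw [Finset.mul_sum, ← Finset.sum_sub_distrib, ← Finset.sum_sub_distrib]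
    refine Finset.sum_congr rfl fun k _ => ?_
    ring
  simp_rw [h0]
  rw [Finset.sum_comm, Finset.mul_sum]
  refine Finset.sum_congr rfl fun k _ => ?_
  have hl := lap_PhZ N 0 k z P
  rw [Complex.ofReal_zero, zero_mul, add_zero] at hl
  rw [← Finset.sum_mul, ← mul_assoc, hl]
  ring

/-- [folklore] **`Σ_k PhZ_k(z)·u_k = e^{ip′·⌊z∕N⌋}`** (`B4Green244.sum_PhZ_V`, `F n 0 k = V n k`). -/
theorem sum_PhZ_F_zero (N : ℕ) [NeZero N] (z : Fin (d + 1) → ℤ) (P : Fin (d + 1) → ℂ) :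
    ∑ k : Fin (d + 1) → Fin N, PhZ N k z P * F N (fun _ => 0) k P = cexp (I * phaseC P (coarse N z)) := by
  simp_rw [F_zero]
  exact sum_PhZ_V N z P

/-- [folklore] **THE BLOCK SUM OF A FINE PHASE**: `Σ_{j} PhZ_k(N•x + j) = N^{d+1}·e^{ip′·x}·ũ_k` (`ũ_k = Fc N 0 k = Π_ν vc`). -/
theorem sum_finePt_PhZ (N : ℕ) [NeZero N] (k : Fin (d + 1) → Fin N) (x : Fin (d + 1) → ℤ) (P : Fin (d + 1) → ℂ) :
    ∑ j : Fin (d + 1) → Fin N, PhZ N k (finePt N x j) P = (N : ℂ) ^ (d + 1) * (cexp (I * phaseC P x) * Fc N (fun _ => 0) k P) := by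
  have hN : N ≠ 0 := NeZero.ne N
  have hNC : (N : ℂ) ≠ 0 := Nat.cast_ne_zero.mpr hN
  simp_rw [PhZ_finePt N hN]
  rw [← Finset.mul_sum]
  have h := Finset.prod_univ_sum (fun _ : Fin (d + 1) => (Finset.univ : Finset (Fin N)))
    (fun ν i => ef N (k ν : ℕ) (i : ℕ) (P ν))
  rw [Fintype.piFinset_univ] at h
  rw [← h]
  have h1 : ∀ ν : Fin (d + 1), ∑ i : Fin N, ef N (k ν : ℕ) (i : ℕ) (P ν) = (N : ℂ) * vc N (k ν) (P ν) := by
    intro ν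
    rw [Fin.sum_univ_eq_sum_range (fun i => ef N (k ν : ℕ) i (P ν)) N]
    unfold vc
    rw [← mul_assoc, mul_inv_cancel₀ hNC, one_mul]
  simp_rw [h1]
  rw [Finset.prod_mul_distrib, Finset.prod_const, Finset.card_univ, Fintype.card_fin]
  unfold Fc
  have h2 : ∀ ν : Fin (d + 1), efc N (k ν : ℕ) ((fun _ => (0 : Fin N)) ν : ℕ) (P ν) = 1 := fun ν => by unfold efc; simp
  simp_rw [h2, one_mul]
  ring

variable (N : ℕ) [NeZero N]

/-- [folklore] **`(−Δ)` ON THE RESPONSE MULTIPLIER, ONCE**: alias `k` acquires `Δ^ξ(p′+2πk)` (fibre eigenvalue; no positivity needed). -/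
theorem negLap_Hfull (s : ℕ) (z : Fin (d + 1) → ℤ) (P : Fin (d + 1) → ℂ) :
    negLap N (fun z' => Hfull N s z' P) z
      = ∑ k : Fin (d + 1) → Fin N, PhZ N k z P * (DeltaXi N 0 (shift N k P) * ((((N : ℂ) ^ (d + 1))⁻¹) * bvec N s P k)) :=
  negLap_sum_PhZ N (fun k => (((N : ℂ) ^ (d + 1))⁻¹) * bvec N s P k) z P

/-- [folklore] **`(−Δ)²` ON THE RESPONSE MULTIPLIER ON THE STRIP**: `negLap N (negLap N Hfull) z = N^{−(d+1)}·((Δ^ξ)^s∕den)·... ` — precisely, at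
order `s = 2`: `= N^{−(d+1)}·((Δ^ξ(p′))²∕den)(p′)·e^{ip′·⌊z∕N⌋}` (FILE 3's `symbol_mul_bvec` + `sum_PhZ_F_zero`). -/
theorem negLap_negLap_Hfull (z : Fin (d + 1) → ℤ) {P : Fin (d + 1) → ℂ} (hP : P ∈ Strip (d + 1) (kappaB (d + 1) 2)) :
    negLap N (negLap N (fun z' => Hfull N 2 z' P)) z
      = (((N : ℂ) ^ (d + 1))⁻¹) * (DeltaXi N 0 P ^ 2 / den N 2 P) * cexp (I * phaseC P (coarse N z)) := by
  have h1 : negLap N (fun z' => Hfull N 2 z' P)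
      = fun z' => ∑ k : Fin (d + 1) → Fin N, PhZ N k z' P * (DeltaXi N 0 (shift N k P) * ((((N : ℂ) ^ (d + 1))⁻¹) * bvec N 2 P k)) := by
    funext z'; exact negLap_Hfull N 2 z' P
  rw [h1, negLap_sum_PhZ]
  have h2 : ∀ k : Fin (d + 1) → Fin N,
      PhZ N k z P * (DeltaXi N 0 (shift N k P) * (DeltaXi N 0 (shift N k P) * ((((N : ℂ) ^ (d + 1))⁻¹) * bvec N 2 P k)))
        = (((N : ℂ) ^ (d + 1))⁻¹) * (DeltaXi N 0 P ^ 2 / den N 2 P) * (PhZ N k z P * F N (fun _ => 0) k P) := fun k => by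
    have hk := symbol_mul_bvec N 2 hP k
    calc PhZ N k z P * (DeltaXi N 0 (shift N k P) * (DeltaXi N 0 (shift N k P) * ((((N : ℂ) ^ (d + 1))⁻¹) * bvec N 2 P k)))
        = (((N : ℂ) ^ (d + 1))⁻¹) * PhZ N k z P * (DeltaXi N 0 (shift N k P) ^ 2 * bvec N 2 P k) := by ring
      _ = (((N : ℂ) ^ (d + 1))⁻¹) * PhZ N k z P * (DeltaXi N 0 P ^ 2 / den N 2 P * F N (fun _ => 0) k P) := by rw [hk]
      _ = (((N : ℂ) ^ (d + 1))⁻¹) * (DeltaXi N 0 P ^ 2 / den N 2 P) * (PhZ N k z P * F N (fun _ => 0) k P) := by ring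
  rw [Finset.sum_congr rfl (fun k _ => h2 k), ← Finset.mul_sum, sum_PhZ_F_zero]

/-- [folklore] **THE BLOCK SUM OF THE RESPONSE MULTIPLIER ON THE STRIP**: `Σ_j Hfull N s (N•y + j) p′ = e^{ip′·y}` (`sum_finePt_PhZ` + FILE 3's unit
block sums `sum_Fc_mul_bvec`). -/
theorem sum_finePt_Hfull (s : ℕ) (y : Fin (d + 1) → ℤ) {P : Fin (d + 1) → ℂ} (hP : P ∈ Strip (d + 1) (kappaB (d + 1) s)) :
    ∑ j : Fin (d + 1) → Fin N, Hfull N s (finePt N y j) P = cexp (I * phaseC P y) := by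
  have hNC : ((N : ℂ) ^ (d + 1)) ≠ 0 := pow_ne_zero _ (Nat.cast_ne_zero.mpr (NeZero.ne N))
  unfold Hfull
  rw [Finset.sum_comm]
  have h1 : ∀ k : Fin (d + 1) → Fin N,
      ∑ j : Fin (d + 1) → Fin N, PhZ N k (finePt N y j) P * ((((N : ℂ) ^ (d + 1))⁻¹) * bvec N s P k)
        = cexp (I * phaseC P y) * (Fc N (fun _ => 0) k P * bvec N s P k) := fun k => by
    rw [← Finset.sum_mul, sum_finePt_PhZ]
    field_simp
  rw [Finset.sum_congr rfl (fun k _ => h1 k), ← Finset.mul_sum, sum_Fc_mul_bvec N s hP, mul_one]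

/-! ## §3 Lattice tools of the junction and the multiplier symbol -/

/-- [folklore] **THE MULTIPLIER SYMBOL** `omegaSym N p′ = (Δ^ξ(p′))²∕den N 2 p′` (`= 1∕Ssum` off the zeros of `Δ^ξ`; holomorphic through `p′ = 0`). -/
def omegaSym (p : Fin (d + 1) → ℂ) : ℂ := DeltaXi N 0 p ^ 2 / den N 2 p

/-- [folklore] Its lattice kernel. -/
def omegaKer (y : Fin (d + 1) → ℤ) : ℂ := latticeKernel (omegaSym (d := d) N) y

/-- [folklore] `−Δ = negLap∕N²` in an2's cochain vocabulary: `codiff₁ (dz f) x = N^{−2}·negLap N f x` for a complex 0-form `f`. -/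
theorem codiff₁_dz_eq_negLap (f : Form0 (d + 1) ℂ) (x : Fin (d + 1) → ℤ) :
    codiff₁ (dz f) x = (((N : ℂ) ^ 2)⁻¹) * negLap N f x := by
  have hNC : ((N : ℂ) ^ 2) ≠ 0 := pow_ne_zero _ (Nat.cast_ne_zero.mpr (NeZero.ne N))
  simp only [codiff₁, dz, negLap, sub_add_cancel]
  rw [← mul_assoc, inv_mul_cancel₀ hNC, one_mul]
  refine Finset.sum_congr rfl fun κ _ => ?_
  show f x - f (x - unitVec κ) - (f (x + unitVec κ) - f x) = 2 * f x - f (x + e κ) - f (x - e κ)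
  simp only [unitVec, e]
  ring

omit [NeZero N] in
/-- [folklore] `negLap` is linear over scalars. -/
theorem negLap_const_mul (c : ℂ) (f : (Fin (d + 1) → ℤ) → ℂ) (z : Fin (d + 1) → ℤ) :
    negLap N (fun z' => c * f z') z = c * negLap N f z := by
  simp only [negLap, Finset.mul_sum]
  refine Finset.sum_congr rfl fun μ _ => ?_
  ring

omit [NeZero N] in
/-- [folklore] `negLap = opD N 0 0` (no mass, no averaging term). -/
theorem negLap_eq_opD (f : (Fin (d + 1) → ℤ) → ℂ) (z : Fin (d + 1) → ℤ) : negLap N f z = opD N 0 0 f z := by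
  simp [opD]

omit [NeZero N] in
/-- [folklore] an2's block sum over the box IS the sum over the finer sites `finePt N y j` (reindexing `box (d+1) N ≃ (Fin (d+1) → Fin N)`). -/
theorem blockSum_eq_sum_finePt {R : Type*} [AddCommMonoid R] (f : (Fin (d + 1) → ℤ) → R) (y : Fin (d + 1) → ℤ) :
    ∑ b ∈ box (d + 1) N, f ((N : ℤ) • y + toSite b) = ∑ j : Fin (d + 1) → Fin N, f (finePt N y j) := by
  refine Finset.sum_bij' (fun b hb => fun ν => ⟨b ν, ?_⟩) (fun j _ => fun ν => (j ν : ℕ)) ?_ ?_ ?_ ?_ ?_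
  · have := (Fintype.mem_piFinset.mp hb) ν
    exact Finset.mem_range.mp this
  · intro b hb; exact Finset.mem_univ _
  · intro j _
    exact Fintype.mem_piFinset.mpr fun ν => Finset.mem_range.mpr (j ν).isLt
  · intro b hb; rfl
  · intro j _; rfl
  · intro b hb
    exact congrArg f (funext fun ν => by simp [finePt, toSite])

/-- [folklore] **STRIP REGULARITY OF THE MULTIPLIER SYMBOL** `(Δ^ξ)²∕den` with the bound `(16(d+1))²∕cB` (holomorphic on the strip; on the sides it is
`1∕Ssum`, periodic by `Ssum_tr`). -/
theorem stripRegular_omegaSym :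
    StripRegular (d := d) (omegaSym N) (kappaB (d + 1) 2) ((16 * ((d + 1 : ℕ) : ℝ)) ^ 2 * (cB (d + 1))⁻¹) := by
  have hκ0 : 0 ≤ kappaB (d + 1) 2 := (kappaB_pos (d + 1) 2).le
  have hN1 : 1 ≤ N := Nat.one_le_iff_ne_zero.mpr (NeZero.ne N)
  have hdiffAt : ∀ p ∈ Strip (d + 1) (kappaB (d + 1) 2), DifferentiableAt ℂ (omegaSym N) p := fun p hp =>
    dAt_div ((differentiableAt_DeltaXi N 0 p).pow 2) (differentiableAt_den_strip N 2 hp) (den_ne_zero_strip N 2 hp)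
  have hside : ∀ {p : Fin (d + 1) → ℂ}, p ∈ Strip (d + 1) (kappaB (d + 1) 2) → ∀ μ, (p μ).re = -Real.pi →
      omegaSym N (tr p μ) = omegaSym N p := by
    intro p hp μ hre
    have hπ := Real.pi_pos
    have hz : p μ ≠ 0 := by
      intro h; rw [h, Complex.zero_re] at hre; linarith
    have hz' : p μ + 2 * Real.pi ≠ 0 := by
      intro h
      have := congrArg Complex.re h
      rw [← tr_apply_self, tr_re_self, hre, Complex.zero_re] at this
      linarith
    have hp1 : tr p μ ∈ Strip (d + 1) (kappaB (d + 1) 2) := tr_mem_Strip hp μ hre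
    obtain ⟨h0, hden, -, -⟩ := unregrouped_hyps N 2 hκ0 le_rfl hp μ (by rw [hre, abs_neg, abs_of_pos hπ])
    obtain ⟨h0', hden', -, -⟩ := unregrouped_hyps N 2 hκ0 le_rfl hp1 μ (by rw [tr_re_self, hre]; ring_nf; exact abs_of_pos hπ)
    have e1 : omegaSym N (tr p μ) = (Ssum N 2 (tr p μ))⁻¹ := by
      unfold omegaSym; rw [← den_div_eq_Ssum N 2 h0', inv_div]
    have e2 : omegaSym N p = (Ssum N 2 p)⁻¹ := by
      unfold omegaSym; rw [← den_div_eq_Ssum N 2 h0, inv_div]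
    rw [e1, e2, Ssum_tr N 2 p μ hz hz']
  refine ⟨?_, ?_, ?_, ?_⟩
  · exact fun p hp => (hdiffAt p hp).continuousAt.continuousWithinAt
  · intro i q hq z hz
    have hP : i.insertNth z (ofRealVec q) ∈ Strip (d + 1) (kappaB (d + 1) 2) :=
      insertNth_mem_Strip hκ0 i hq (openRect_subset_closedRect _ hz)
    exact ((hdiffAt _ hP).comp z (differentiableAt_insertNth i _ z)).differentiableWithinAt
  · intro i q hq y hy
    obtain ⟨hP, hre⟩ := insertNth_left_mem hκ0 i hq hy
    rw [← tr_insertNth_left]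
    exact (hside hP i hre).symm
  · intro p hp
    have hfat : p ∈ Fat (d + 1) (rOf (d + 1)) := fat_of_strip 2 hp
    unfold omegaSym
    rw [norm_div, div_eq_mul_inv]
    have h1 := norm_DeltaXi_le N hN1 0 le_rfl (rOf_le (d + 1)) hfat
    rw [add_zero] at h1
    have h2 : ‖den N 2 p‖⁻¹ ≤ (cB (d + 1))⁻¹ := by
      rw [← norm_inv]; exact norm_inv_den_le_strip N 2 hp
    rw [norm_pow]
    have hcB := cB_pos (d + 1)
    exact mul_le_mul (pow_le_pow_left₀ (norm_nonneg _) h1 2) h2 (by positivity) (by positivity)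

end Summit.QuantumFields.BalabanUV.Beta.FP.ConstrainedBiLaplacianResponseFull

end
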